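/-
COR-CM (cell pub-hodgecm2, stage 2 of the Hodge ladder) — junction B01 `PerLFace_of_PerL`: HECKE TRANSLATIONS of compact ball
quotients ARE MORPHISMS of the algebraic models (step S2 of the discharge of the displayed leaf `Universe.HeckeWedge10` of
`CorCM/B01/FaceInputsSplit.lean`, ROUTES-B01.md v3 §8).  Seat prover-pub-hodgecm2-own-b01-0 (single owner of B01), 2026-08-21.
One definition (`UnitaryBallUniformisationDatum.translate`, the γ-transport of a uniformisation datum) and theorems; nothing
cited as a record, nothing asserted; the analytic/algebraic input is b10's tree brick
`UnitaryBallLevelCovering.exists_hom_map_unif_eq` and the tree theorem `arapura2012_cor_15_4_6_holds`.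
-/
import Literature.AlgebraicGeometry.ShimuraVarieties.UnitaryBallLevelCovering
import Literature.NumberTheory.Automorphic.UnitaryGroupArithmeticLevelPairs
import Literature.NumberTheory.Transcendental.AnalytificationMorphismsProofs
import Literature.AlgebraicGeometry.HodgeTheory.BettiUniverseAxioms
import HarnessLib

/-!
# Hecke translations `z ↦ γ z` of compact ball quotients are morphisms of the algebraic models

Let `D : UnitaryBallUniformisationDatum 2 X` exhibit the smooth projective surface `X/ℂ` as `Γ\𝔹²` (`unif : cone → X(ℂ)`
with fibres the `Γ·ℂˣ`-orbits), and let `γ ∈ U(H)(E)` be a RATIONAL isometry of the hermitian space.  The TRANSLATED datum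
`D.translate γ hγ` on the SAME scheme `X` has group `γ Γ γ⁻¹` and uniformisation `v ↦ unif (γ⁻¹ v)`: it exhibits `X(ℂ)` as
`(γΓγ⁻¹)\𝔹²` — all eleven clauses are transported (congruence of the conjugate group through the tree's adelic
characterisation `UnitaryGroup.isCongruenceSubgroup_conjRingHom_iff` + `arithmeticLevel_map_conj`; the topological and
holomorphy clauses by composing with the linear automorphism `γ⁻¹` of the negative cone).  Consequently, for a second datum
`D₂ : UnitaryBallUniformisationDatum 2 X₂` with the same hermitian space and `γ Γ γ⁻¹ ≤ Γ₂` (e.g. `Γ ≤ Γ₂ ∩ γ⁻¹ Γ₂ γ`), b10's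
brick `UnitaryBallLevelCovering.exists_hom_map_unif_eq` (the level covering of the analytifications is holomorphic, hence a
morphism — Arapura 2012 Cor. 15.4.6, a tree theorem) applied to `(D.translate γ, D₂)` yields

* `exists_hom_map_unif_eq_act` — **a morphism `g : X ⟶ X₂` of `ℂ`-schemes with `g(ℂ) (unif v) = unif₂ (γ v)` on the cone**:
  the HECKE TRANSLATION `Γ\𝔹² → Γ₂\𝔹²`, `Γz ↦ Γ₂ γz`, is a morphism of the algebraic models.

This is the `g` (and, with `γ = 1`, the `h`) of the displayed leaf `Universe.HeckeWedge10` (shape of Venkataramana 2001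
Thm 8 / Clozel 1993: `∃ g ∈ G_f, g(a) ∧ a′ ≠ 0`) read on the model universe; the U_rec-level corollary for
`Model.picardCMUniverse` is the sequel section of this file.  References (provenance of the construction, not records):
N. Bergeron, J. Millson, C. Moeglin, Acta Math. 216 (2016), Part 2 §3 (Hecke correspondences on the tower of ball
quotients); V. Platonov, A. Rapinchuk, *Algebraic Groups and Number Theory* (1994) §4.1 (conjugates of arithmetic subgroups
by rational points are arithmetic).
-/

noncomputable section

open Matrix Function Set
open Literature.AlgebraicGeometry.Motives (SchemeOver ComplexPoints AlgPoints)
open Literature.AlgebraicGeometry.HodgeTheory (HodgeModel exists_isReal_hodgeModel)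
open Literature.NumberTheory.Transcendental (arapura2012_cor_15_4_6_holds)
open Literature.NumberTheory.Automorphic
open CategoryTheory NumberField

namespace Summit.HodgeConjecture.CorCM.BallDatum

open Literature.AlgebraicGeometry.ShimuraVarieties
open Literature.AlgebraicGeometry.ShimuraVarieties.UnitaryBallUniformisationDatum

variable {X : SchemeOver ℂ} (D : UnitaryBallUniformisationDatum 2 X)

/-! ### The linear automorphism of the cone given by a rational isometry -/

/-- Rational ISOMETRIES preserve the negative cone (the tree's `act_mem_cone` for `γ ∈ Γ`, verbatim for
`γ ∈ U(H)(E)`). [folklore] -/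
theorem act_mem_cone_of_mem_unitaryGroup {γ : GL (Fin 3) D.E} (hγ : γ ∈ unitaryGroup (conjRingHom D.E) D.H)
    {v : Fin 3 → ℂ} (hv : v ∈ D.cone) : D.act γ v ∈ D.cone := by
  have hu := D.conjTranspose_mul_Hℂ_mul hγ
  change (star ((((γ : Matrix (Fin 3) (Fin 3) D.E)).map D.τ₁) *ᵥ v) ⬝ᵥ
    (D.Hℂ *ᵥ ((((γ : Matrix (Fin 3) (Fin 3) D.E)).map D.τ₁) *ᵥ v))).re < 0
  rw [star_mulVec, mulVec_mulVec, dotProduct_mulVec, vecMul_vecMul, ← Matrix.mul_assoc, hu,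
    ← dotProduct_mulVec]
  exact hv

/-- `γ⁻¹ (γ v) = v` for the action through `τ₁`. [folklore] -/
theorem act_inv_act (γ : GL (Fin 3) D.E) (v : Fin 3 → ℂ) : D.act γ⁻¹ (D.act γ v) = v := by
  change (((γ⁻¹ : GL (Fin 3) D.E) : Matrix (Fin 3) (Fin 3) D.E).map D.τ₁) *ᵥ
    ((((γ : Matrix (Fin 3) (Fin 3) D.E)).map D.τ₁) *ᵥ v) = v
  rw [mulVec_mulVec, ← Matrix.map_mul, Units.inv_mul, Matrix.map_one D.τ₁ (map_zero _) (map_one _),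
    Matrix.one_mulVec]

/-- `γ (γ⁻¹ v) = v`. [folklore] -/
theorem act_act_inv (γ : GL (Fin 3) D.E) (v : Fin 3 → ℂ) : D.act γ (D.act γ⁻¹ v) = v := by
  simpa using act_inv_act D γ⁻¹ v

/-- The action through `τ₁` is multiplicative: `(γ δ) v = γ (δ v)`. [folklore] -/
theorem act_mul (γ δ : GL (Fin 3) D.E) (v : Fin 3 → ℂ) : D.act (γ * δ) v = D.act γ (D.act δ v) := by
  change ((((γ * δ : GL (Fin 3) D.E) : Matrix (Fin 3) (Fin 3) D.E)).map D.τ₁) *ᵥ v = _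
  rw [Units.val_mul, Matrix.map_mul, ← mulVec_mulVec]

/-- The action through `τ₁` commutes with complex scalars. [folklore] -/
theorem act_smul (γ : GL (Fin 3) D.E) (c : ℂ) (v : Fin 3 → ℂ) : D.act γ (c • v) = c • D.act γ v :=
  mulVec_smul _ _ _

/-- The action through `τ₁` is continuous. [folklore] -/
theorem continuous_act (γ : GL (Fin 3) D.E) : Continuous (D.act γ) :=
  continuous_const.matrix_mulVec continuous_id

/-- The action through `τ₁` is complex-differentiable (it is `ℂ`-linear). [folklore] -/
theorem differentiable_act (γ : GL (Fin 3) D.E) : Differentiable ℂ (D.act γ) :=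
  (Matrix.mulVecLin (((γ : Matrix (Fin 3) (Fin 3) D.E)).map D.τ₁)).toContinuousLinearMap.differentiable

/-! ### Congruence subgroups are stable under conjugation by rational isometries -/

/-- **`γ Γ γ⁻¹` is a congruence subgroup** for `Γ` a congruence subgroup of `U(H)(E⁺)` and `γ ∈ U(H)(E)` rational:
`Γ = Γ(K)` for a compact open `K ≤ U(H)(𝔸_f)` (Getz–Hahn Ex. 2.17, the tree's
`isCongruenceSubgroup_conjRingHom_iff`), and `γ Γ(K) γ⁻¹ = Γ(γ_f K γ_f⁻¹)` (Platonov–Rapinchuk §4.1, the tree's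
`arithmeticLevel_map_conj`) with `γ_f K γ_f⁻¹` compact open. [folklore] -/
theorem isCongruenceSubgroup_map_conj {E : Subfield ℂ} [NumberField E] [IsCMField E] {H : Matrix (Fin 3) (Fin 3) E}
    {Γ : Subgroup (GL (Fin 3) E)} (hΓ : IsCongruenceSubgroup (conjRingHom E) H Γ)
    {γ : GL (Fin 3) E} (hγ : γ ∈ unitaryGroup (conjRingHom E) H) :
    IsCongruenceSubgroup (conjRingHom E) H (Γ.map (MulAut.conj γ).toMonoidHom) := by
  obtain ⟨K, hKc, hKo, hK⟩ := (UnitaryGroup.isCongruenceSubgroup_conjRingHom_iff H).1 hΓ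
  have hγ' : γ ∈ UnitaryGroup.rational (maximalRealSubfield E) E (IsCMField.complexConj E) 3 H := by
    rwa [← UnitaryGroup.unitaryGroup_conjRingHom_eq_rational]
  refine (UnitaryGroup.isCongruenceSubgroup_conjRingHom_iff H).2
    ⟨K.map (MulAut.conj (UnitaryGroup.rationalToFinAdelic (maximalRealSubfield E) E (IsCMField.complexConj E) 3 H
      ⟨γ, hγ'⟩)).toMonoidHom, Subgroup.isCompact_map_conj hKc _, Subgroup.isOpen_map_conj hKo _, ?_⟩
  rw [UnitaryGroup.arithmeticLevel_map_conj, hK]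

/-! ### The translated datum -/

/-- A conjugate `γ δ γ⁻¹` of finite order has `δ` of finite order. [folklore] -/
theorem isOfFinOrder_of_conj {G : Type*} [Group G] (γ δ : G) (h : IsOfFinOrder (γ * δ * γ⁻¹)) : IsOfFinOrder δ := by
  have h' := (MulAut.conj γ⁻¹).toMonoidHom.isOfFinOrder h
  simpa [MulAut.conj_apply, mul_assoc] using h'

/-- **The γ-TRANSLATE of a uniformisation datum** by a rational isometry `γ ∈ U(H)(E)`: same field, same hermitian space,
group `γ Γ γ⁻¹`, uniformisation `v ↦ unif (γ⁻¹ v)` — it exhibits the SAME surface `X` as `(γΓγ⁻¹)\𝔹²`.  All clauses are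
transported: congruence (`isCongruenceSubgroup_map_conj`), torsion-freeness (conjugation preserves the order), continuity /
openness / surjectivity / holomorphy in algebraic coordinates (composition with the linear automorphism `γ⁻¹` of the negative
cone), and the fibre clause (`unif (γ⁻¹ v) = unif (γ⁻¹ w) ↔ v, w` in one `γΓγ⁻¹·ℂˣ`-orbit). [folklore] -/
def translate (γ : GL (Fin 3) D.E) (hγ : γ ∈ unitaryGroup (conjRingHom D.E) D.H) : UnitaryBallUniformisationDatum 2 X where
  E := D.E
  H := D.H
  conj_H_apply := D.conj_H_apply
  anisotropic := D.anisotropic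
  signature_τ₁ := D.signature_τ₁
  posDef_of_ne := D.posDef_of_ne
  Γ := D.Γ.map (MulAut.conj γ).toMonoidHom
  isCongruenceSubgroup := isCongruenceSubgroup_map_conj D.isCongruenceSubgroup hγ
  torsionFree := by
    intro δ hδ hfin
    obtain ⟨δ₀, hδ₀, rfl⟩ := Subgroup.mem_map.1 hδ
    have h0 : IsOfFinOrder δ₀ :=
      isOfFinOrder_of_conj γ δ₀ (by simpa [MulAut.conj_apply] using hfin)
    rw [D.torsionFree δ₀ hδ₀ h0, map_one]
  unif := fun v => D.unif (D.act γ⁻¹ v)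
  continuousOn_unif :=
    D.continuousOn_unif.comp (continuous_act D γ⁻¹).continuousOn
      (fun _ hv => act_mem_cone_of_mem_unitaryGroup D (inv_mem hγ) hv)
  isOpenMap_unif := by
    -- `γ⁻¹` restricts to a homeomorphism of the cone, and `unif ∘ γ⁻¹ = unif ∘ (that homeomorphism)` on the cone
    let e : D.cone ≃ₜ D.cone :=
      { toFun := fun v => ⟨D.act γ⁻¹ v, act_mem_cone_of_mem_unitaryGroup D (inv_mem hγ) v.2⟩
        invFun := fun v => ⟨D.act γ v, act_mem_cone_of_mem_unitaryGroup D hγ v.2⟩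
        left_inv := fun v => Subtype.ext (act_act_inv D γ v)
        right_inv := fun v => Subtype.ext (act_inv_act D γ v)
        continuous_toFun := ((continuous_act D γ⁻¹).comp continuous_subtype_val).subtype_mk _
        continuous_invFun := ((continuous_act D γ).comp continuous_subtype_val).subtype_mk _ }
    have hcomp : (negCone (D.H.map D.E.subtype)).restrict (fun v => D.unif (D.act γ⁻¹ v)) =
        D.cone.restrict D.unif ∘ e := funext fun _ => rfl
    rw [hcomp]
    exact D.isOpenMap_unif.comp e.isOpenMap
  surjOn_unif := by
    intro P _
    obtain ⟨v, hv, rfl⟩ := D.surjOn_unif (mem_univ P)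
    refine ⟨D.act γ v, act_mem_cone_of_mem_unitaryGroup D hγ hv, ?_⟩
    change D.unif (D.act γ⁻¹ (D.act γ v)) = D.unif v
    rw [act_inv_act]
  unif_eq_unif_iff := by
    intro v hv w hw
    have hv' : D.act γ⁻¹ v ∈ D.cone := act_mem_cone_of_mem_unitaryGroup D (inv_mem hγ) hv
    have hw' : D.act γ⁻¹ w ∈ D.cone := act_mem_cone_of_mem_unitaryGroup D (inv_mem hγ) hw
    change D.unif (D.act γ⁻¹ v) = D.unif (D.act γ⁻¹ w) ↔
      ∃ δ ∈ D.Γ.map (MulAut.conj γ).toMonoidHom, ∃ c : ℂ, c ≠ 0 ∧ D.act δ v = c • w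
    rw [D.unif_eq_unif_iff _ hv' _ hw']
    constructor
    · rintro ⟨δ₀, hδ₀, c, hc, h⟩
      refine ⟨(MulAut.conj γ).toMonoidHom δ₀, Subgroup.mem_map_of_mem _ hδ₀, c, hc, ?_⟩
      change D.act (γ * δ₀ * γ⁻¹) v = c • w
      have h' : D.act δ₀ (D.act γ⁻¹ v) = c • D.act γ⁻¹ w := h
      rw [act_mul, act_mul, h', act_smul, act_act_inv]
    · rintro ⟨δ, hδ, c, hc, h⟩
      obtain ⟨δ₀, hδ₀, rfl⟩ := Subgroup.mem_map.1 hδ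
      refine ⟨δ₀, hδ₀, c, hc, ?_⟩
      have h' : D.act (γ * δ₀ * γ⁻¹) v = c • w := h
      change D.act δ₀ (D.act γ⁻¹ v) = c • D.act γ⁻¹ w
      have e : δ₀ * γ⁻¹ = γ⁻¹ * (γ * δ₀ * γ⁻¹) := by group
      rw [← act_mul, e, act_mul, h', act_smul]
  differentiableOn_unif := by
    intro U s
    refine (D.differentiableOn_unif U s).comp (differentiable_act D γ⁻¹).differentiableOn ?_
    rintro v ⟨hv, hP⟩
    exact ⟨act_mem_cone_of_mem_unitaryGroup D (inv_mem hγ) hv, hP⟩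
  isSmoothProjective := D.isSmoothProjective

section TranslateLemmas

variable (γ : GL (Fin 3) D.E) (hγ : γ ∈ unitaryGroup (conjRingHom D.E) D.H)

/-- The translate has the same field. [folklore] -/
@[simp] theorem translate_E : (translate D γ hγ).E = D.E := rfl
/-- The translate has the same Gram matrix. [folklore] -/
@[simp] theorem translate_H : (translate D γ hγ).H = D.H := rfl
/-- The translate has the same complex hermitian space. [folklore] -/
theorem translate_Hℂ : (translate D γ hγ).Hℂ = D.Hℂ := rfl
/-- The translate has the same negative cone. [folklore] -/
theorem translate_cone : (translate D γ hγ).cone = D.cone := rfl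
/-- The group of the translate is `γ Γ γ⁻¹`. [folklore] -/
theorem translate_Γ : (translate D γ hγ).Γ = D.Γ.map (MulAut.conj γ).toMonoidHom := rfl
/-- The uniformisation of the translate is `unif ∘ γ⁻¹`. [folklore] -/
theorem translate_unif (v : Fin 3 → ℂ) : (translate D γ hγ).unif v = D.unif (D.act γ⁻¹ v) := rfl

end TranslateLemmas

/-! ### Hecke translations are morphisms -/

/-- **The Hecke translation `Γz ↦ Γ₂ γz` is a morphism of the algebraic models.**  For two uniformisation data `D` (on `X`)
and `D₂` (on `X₂`) with the same complex hermitian space, a rational isometry `γ ∈ U(H)(E)` with `γ Γ γ⁻¹ ≤ Γ₂` (read in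
`GL₃(ℂ)`), and Hodge models (analytifications) `A₁`, `A₂`: there is `g : X ⟶ X₂` over `ℂ` with `g(ℂ) (unif v) = unif₂ (γ v)` on
the negative cone — b10's brick `UnitaryBallLevelCovering.exists_hom_map_unif_eq` (level coverings are holomorphic, hence
morphisms: Arapura 2012 Cor. 15.4.6, the tree theorem `arapura2012_cor_15_4_6_holds`) applied to the translated datum
`D.translate γ`. [folklore] -/
theorem exists_hom_map_unif_eq_act {X₂ : SchemeOver ℂ} (D₂ : UnitaryBallUniformisationDatum 2 X₂)
    {γ : GL (Fin 3) D.E} (hγ : γ ∈ unitaryGroup (conjRingHom D.E) D.H) (hH : D.Hℂ = D₂.Hℂ)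
    (hΓ : (D.Γ.map (MulAut.conj γ).toMonoidHom).map (Matrix.GeneralLinearGroup.map D.τ₁) ≤
      D₂.Γ.map (Matrix.GeneralLinearGroup.map D₂.τ₁))
    (A₁ : HodgeModel 2 X) (A₂ : HodgeModel 2 X₂) :
    ∃ g : X ⟶ X₂, ∀ v ∈ D.cone, AlgPoints.map g (D.unif v) = D₂.unif (D.act γ v) := by
  obtain ⟨g, hg⟩ := UnitaryBallLevelCovering.exists_hom_map_unif_eq (D₁ := translate D γ hγ) (D₂ := D₂)
    arapura2012_cor_15_4_6_holds hH hΓ A₁ A₂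
  refine ⟨g, fun v hv => ?_⟩
  have h := hg (D.act γ v) (act_mem_cone_of_mem_unitaryGroup D hγ hv)
  rw [translate_unif, act_inv_act] at h
  exact h

/-- The same with the Hodge models supplied by the Hodge decomposition record `hHD` (the tree's
`BettiUniverse.realHodgeModel`; `hHD` itself is the tree theorem `exists_isReal_hodgeModel_holds`). [folklore] -/
theorem exists_hom_map_unif_eq_act' (hHD : exists_isReal_hodgeModel) {X₂ : SchemeOver ℂ}
    (D₂ : UnitaryBallUniformisationDatum 2 X₂) {γ : GL (Fin 3) D.E} (hγ : γ ∈ unitaryGroup (conjRingHom D.E) D.H)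
    (hH : D.Hℂ = D₂.Hℂ)
    (hΓ : (D.Γ.map (MulAut.conj γ).toMonoidHom).map (Matrix.GeneralLinearGroup.map D.τ₁) ≤
      D₂.Γ.map (Matrix.GeneralLinearGroup.map D₂.τ₁)) :
    ∃ g : X ⟶ X₂, ∀ v ∈ D.cone, AlgPoints.map g (D.unif v) = D₂.unif (D.act γ v) :=
  exists_hom_map_unif_eq_act D D₂ hγ hH hΓ
    (Literature.AlgebraicGeometry.HodgeTheory.BettiUniverse.realHodgeModel hHD D.isSmoothProjective)
    (Literature.AlgebraicGeometry.HodgeTheory.BettiUniverse.realHodgeModel hHD D₂.isSmoothProjective)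

end Summit.HodgeConjecture.CorCM.BallDatum

end
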